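import Literature.IUT.HodgeArakelov.ThetaEvaluationSettingProofs3
import Literature.IUT.HodgeArakelov.EtaleThetaDataOfSetting
import Literature.AnabelianGeometry.EtaleTheta.ContH1ConjAction
import Literature.AnabelianGeometry.EtaleTheta.ContH1Lemmas

/-!
# [IUTchII] Prop 2.2 (i)′/(ii)′ at the MODEL `Π_v = Π^tp_X̲̲` of [EtTh] §2 (fourth proof-only companion)

Proof-only companion (abc-iut cell, D-0067 wave 4, cone of [IUTchIII] Cor. 3.12; nodes **IUTchII:Prop2.2(i)**,
**IUTchII:Prop2.2(ii)**; no definitions). S. Mochizuki, *Inter-universal Teichmüller theory II*, kurims manuscript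
(Dec. 2020) §2, Prop. 2.2 p. 66 (claim key `Mochizuki2012`, DISPUTED, D-0012); [EtTh] §2 p. 41 "`Π^tp_X/Π^tp_Ÿ ≅ ℤ × μ₂`",
Def. 2.7 ("the `(l·ℤ × μ_2)`-orbit `η̈^{Θ,l·ℤ×μ_2}` of an `l`-th root"). Nothing here takes a side on [IUTchIII] Cor. 3.12.

The abstract discharges of `ThetaEvaluationSettingProofs2/3.lean` are specialised to the Prop. 1.4 output
`D := etaleThetaDataOfSetting'` (abc-iut-L6-t1's bridge `EtaleThetaDataOfSetting.lean`: `Π := Π^tp_X̲̲` of [EtTh] §2 from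
abc-iut-L2-t8's `DoubleUnderline C`, REAL continuous cohomology, `orbit := orbitOne` = the `Π^tp_X̲̲`-conjugacy orbit of the
class `rootLiftClass` of ONE `l`-th root `η̲̈^Θ`):

* `prop22_i'_etaleThetaDataOfSetting` — **Prop. 2.2 (i)′** at the model: the normality input `Π_Ÿ(Π_v) ⊴ Π_v` of
  `prop22_i'_of_groupTheoretic` IS L6-t1's `EtaleThetaDataOfSetting.piYdd_normal`; what remains are the landed
  anabelian input `SubgraphReference.GroupTheoretic` and `Π_{v•}·Δ = Π_v` (plan/GAP-LEDGER.md G-w4d010-1, narrowed).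
* `orbitOne_subset_translates` — **the `(l·ℤ) × μ₂`-description of the orbit**, PROVED (pure group theory over
  L2's files): for `γ ∈ Π^tp_X̲̲` mapping to `1` under L2-t8's `toLZ : Π^tp_X̲̲ ↠ ℤ` (kernel `Π^tp_Y̲̲`) and
  `ε ∈ Π^tp_Y̲̲ ∖ Π^tp_Ÿ̲̲` (`[Π^tp_Y̲̲ : Π^tp_Ÿ̲̲] = 2`, L2-t8 `relIndex_GtpYdd_inf`), every member of `orbitOne` is the
  `γⁿ`- or the `γⁿ·ε`-conjugate of the root class (`Π^tp_Ÿ̲̲` acts trivially on `H¹(Π^tp_Ÿ̲̲, l·Δ_Θ)`: L2-t1's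
  `ContH1.conj_eq_self_of_mem`).
* `orbitOne_desc_of_sign` — hence hypothesis `hdesc` of `prop22_ii'_of_translates` ("orbit = translates `τ n` up to
  `2`-torsion classes", `τ n :=` the `γⁿ`-conjugate) HOLDS at the model as soon as `ε` moves the root class by a class
  of order dividing `2` — [EtTh] Prop. 1.4 (ii) "`Θ̈(−Ü) = −Θ̈(Ü)`" AT THE CLASS LEVEL (hypothesis `hsign`; the tree's
  `etaDd` is abstract data, so this is an INPUT, GAP-LEDGER G-w4d010-2 (P14ii-cl));
* `prop22_ii'_etaleThetaDataOfSetting` — **Prop. 2.2 (ii)′** at the model: `Prop22_ii'` for any `SubgraphDecomposition`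
  over `D` from: the `ι`-actions `ρ`, `ρlim` (compatible, stabilising the orbit — supplied by L6-t1's
  `CohomologyAutFunctoriality` once the pointed inversion is fixed), `hsign`, `ι` reverses the translates up to
  torsion (`hrev`), distinct translates differ by non-torsion classes (`hfree`, [EtTh] Prop. 1.4 (i)/(iii) at the
  class level, G-w4d010-2 (P14iii-cl)); `hτ0` and `hdesc` are DISCHARGED here.
-/

namespace Literature.IUT.HodgeArakelov

open Literature.AnabelianGeometry.EtaleTheta (ContH1)
open EtaleThetaDataOfSetting

noncomputable section

variable {p : ℕ} [Fact p.Prime] {D : Literature.AnabelianGeometry.EtaleTheta.ThetaSetting p}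
  {E : D.EtaleThetaData} {l : ℕ} (C : E.DoubleUnderline l)

/-- **IUTchII:Prop2.2(i)′ at the model `Π_v := Π^tp_X̲̲`** ([IUTchII] Prop. 2.2 (i), kurims p. 66, over [EtTh] §2):
for the Prop. 1.4 output `D := etaleThetaDataOfSetting' C hC hS hchar S eS hl` (abc-iut-L6-t1's bridge, one-root
orbit, `S.l = l`), the repaired statement `Prop22_i' R T D ι₀` HOLDS given the landed anabelian input
`R.GroupTheoretic` ([SemiAnbd] Cor. 3.11 / [AbsTopI] Thm. 2.14 (i)) and `Π_{v•}·Δ = Π_v` along one identification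
with the reference (the decomposition group of the vertex `0` surjects onto the Galois group) — the normality input
of `prop22_i'_of_groupTheoretic` being L6-t1's `piYdd_normal` (`Ÿ̲̲ → X̲̲` Galois, [EtTh] §2 p. 41).
[claim: Mochizuki2012, status: disputed] (IUTchII §2 Prop 2.2 (i), kurims pp.66-67) -/
theorem prop22_i'_etaleThetaDataOfSetting (hC : D.Compat) (hS : D.Sec2Hyps) (hchar : PiYddCharacteristic C)
    (S : BadPlaceSetting.{0}) (eS : (Pi C) ≃ₜ* S.PiX) (hl : S.l = l)
    (R : SubgraphReference S) (T : TemperedCoverings S (Pi C)) {G : EnvOfGroup S.toThetaSetting (Pi C)}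
    (ι₀ : PointedInversion G (etaleThetaDataOfSetting' C hC hS hchar S.toThetaSetting eS hl))
    (hG : R.GroupTheoretic)
    (hsurj : ∃ e₀ : (Pi C) ≃ₜ* S.PiX, ∀ x : Pi C, ∃ b : Pi C, e₀ b ∈ R.refBullet ∧
      G.recon.projG (G.isoX b) = G.recon.projG (G.isoX x)) :
    Prop22_i' R T (etaleThetaDataOfSetting' C hC hS hchar S.toThetaSetting eS hl) ι₀ :=
  prop22_i'_of_groupTheoretic R T _ ι₀ hG (piYdd_normal C hC) hsurj

/-- **Generators of `Π^tp_X̲̲/Π^tp_Ÿ̲̲ ≅ (l·ℤ) × μ₂`** exist: an element `γ ∈ Π^tp_X̲̲` mapping to `1` under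
`toLZ : Π^tp_X̲̲ ↠ ℤ` (L2-t8 `toLZ_surjective`) and an element `ε ∈ Π^tp_Y̲̲ ∖ Π^tp_Ÿ̲̲` (`[Π^tp_Y̲̲ : Π^tp_Ÿ̲̲] = 2`,
L2-t8 `relIndex_GtpYdd_inf`). [cite: MochizukiEtTh2009, Def 2.7 p.41] -/
theorem exists_translation_generators (hS : D.Sec2Hyps) :
    ∃ γ ε : Pi C, C.toLZ γ = Multiplicative.ofAdd 1 ∧ (ε : D.PiTemp) ∈ D.GtpY ∧ (ε : D.PiTemp) ∉ D.GtpYdd := by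
  obtain ⟨γ, hγ⟩ := C.toLZ_surjective (Multiplicative.ofAdd 1)
  have h2 : (D.GtpYdd.subgroupOf (C.Huu ⊓ D.GtpY)).index = 2 := C.relIndex_GtpYdd_inf hS
  have hne : D.GtpYdd.subgroupOf (C.Huu ⊓ D.GtpY) ≠ ⊤ := by
    intro htop
    rw [htop, Subgroup.index_top] at h2
    exact absurd h2 (by norm_num)
  obtain ⟨a, ha⟩ : ∃ a : ↥(C.Huu ⊓ D.GtpY), a ∉ D.GtpYdd.subgroupOf (C.Huu ⊓ D.GtpY) := by
    by_contra h
    exact hne (eq_top_iff.mpr fun a _ => not_not.mp (not_exists.mp h a))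
  refine ⟨γ, ⟨(a : D.PiTemp), (Subgroup.mem_inf.mp a.2).1⟩, hγ, (Subgroup.mem_inf.mp a.2).2, ?_⟩
  rw [Subgroup.mem_subgroupOf] at ha
  exact ha

variable [hN : (PiYdd C).Normal]

/-- **The `(l·ℤ) × μ₂`-description of the one-root orbit** ([EtTh] Def. 2.7 p. 41: "the `(l·ℤ × μ_2)`-orbit
`η̈^{Θ,l·ℤ×μ_2}`"; `Π^tp_X̲̲/Π^tp_Ÿ̲̲ ≅ (l·ℤ) × μ₂`), PROVED: with `γ ↦ 1` under `toLZ : Π^tp_X̲̲ ↠ ℤ` (kernel `Π^tp_Y̲̲`,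
L2-t8 `toLZ_ker`) and `ε ∈ Π^tp_Y̲̲ ∖ Π^tp_Ÿ̲̲`, every `Π^tp_X̲̲`-conjugate of the root class `η̲̈^Θ` is its `γⁿ`-conjugate or
its `γⁿ·ε`-conjugate for some `n ∈ ℤ` — since `σ = γⁿ·(ε)·y` with `y ∈ Π^tp_Ÿ̲̲` (index `2`: Mathlib
`Subgroup.mul_mem_iff_of_index_two`) and `Π^tp_Ÿ̲̲` acts trivially on `H¹(Π^tp_Ÿ̲̲, l·Δ_Θ)` (L2-t1
`ContH1.conj_eq_self_of_mem`). [cite: MochizukiEtTh2009, Def 2.7 p.41] -/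
theorem orbitOne_subset_translates (hC : D.Compat) (hS : D.Sec2Hyps) (γ ε : Pi C)
    (hγ : C.toLZ γ = Multiplicative.ofAdd 1) (hε₁ : (ε : D.PiTemp) ∈ D.GtpY) (hε₂ : (ε : D.PiTemp) ∉ D.GtpYdd)
    {o : (coh C).H1 ⊤} (ho : o ∈ orbitOne C hC) :
    ∃ n : ℤ, o = (h1Top C).symm (Additive.ofMul
        (ContH1.conj (phi C) (D.lDeltaTheta l) (γ ^ n) (rootLiftClass C))) ∨
      o = (h1Top C).symm (Additive.ofMul
        (ContH1.conj (phi C) (D.lDeltaTheta l) (γ ^ n * ε) (rootLiftClass C))) := by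
  obtain ⟨σ, rfl⟩ := ho
  set n : ℤ := Multiplicative.toAdd (C.toLZ σ) with hn
  -- `y := γ⁻ⁿ σ ∈ Π^tp_Y̲̲`
  have hyY : (((γ ^ n)⁻¹ * σ : Pi C) : D.PiTemp) ∈ D.GtpY := by
    have hker : (γ ^ n)⁻¹ * σ ∈ C.toLZ.ker := by
      rw [MonoidHom.mem_ker, map_mul, map_inv, map_zpow, hγ, ← ofAdd_zsmul, smul_eq_mul, mul_one, hn,
        ofAdd_toAdd, inv_mul_cancel]
    rw [C.toLZ_ker, Subgroup.mem_subgroupOf] at hker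
    exact hker
  refine ⟨n, ?_⟩
  by_cases hyYdd : (((γ ^ n)⁻¹ * σ : Pi C) : D.PiTemp) ∈ D.GtpYdd
  · -- `σ = γⁿ · y`, `y ∈ Π^tp_Ÿ̲̲`
    left
    have hy : (γ ^ n)⁻¹ * σ ∈ PiYdd C ⊓ ⊤ :=
      Subgroup.mem_inf.mpr ⟨Subgroup.mem_subgroupOf.mpr (Subgroup.mem_inf.mpr ⟨hyYdd, ((γ ^ n)⁻¹ * σ).2⟩),
        Subgroup.mem_top _⟩
    have hσ : σ = γ ^ n * ((γ ^ n)⁻¹ * σ) := (mul_inv_cancel_left _ _).symm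
    conv_lhs => rw [hσ, ContH1.conj_mul_apply, ContH1.conj_eq_self_of_mem _ hy]
  · -- `σ = γⁿ · ε · y'`, `y' := ε⁻¹ γ⁻ⁿ σ ∈ Π^tp_Ÿ̲̲` by the index-`2` count
    right
    have h2 : (D.GtpYdd.subgroupOf (C.Huu ⊓ D.GtpY)).index = 2 := C.relIndex_GtpYdd_inf hS
    let aε : ↥(C.Huu ⊓ D.GtpY) := ⟨(ε : D.PiTemp), Subgroup.mem_inf.mpr ⟨ε.2, hε₁⟩⟩
    let ay : ↥(C.Huu ⊓ D.GtpY) :=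
      ⟨(((γ ^ n)⁻¹ * σ : Pi C) : D.PiTemp), Subgroup.mem_inf.mpr ⟨((γ ^ n)⁻¹ * σ).2, hyY⟩⟩
    have hprod : aε⁻¹ * ay ∈ D.GtpYdd.subgroupOf (C.Huu ⊓ D.GtpY) := by
      rw [Subgroup.mul_mem_iff_of_index_two h2, inv_mem_iff, Subgroup.mem_subgroupOf,
        Subgroup.mem_subgroupOf]
      exact ⟨fun h => absurd h hε₂, fun h => absurd h hyYdd⟩
    rw [Subgroup.mem_subgroupOf] at hprod
    have hy' : ε⁻¹ * ((γ ^ n)⁻¹ * σ) ∈ PiYdd C ⊓ ⊤ :=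
      Subgroup.mem_inf.mpr ⟨Subgroup.mem_subgroupOf.mpr
        (Subgroup.mem_inf.mpr ⟨hprod, (ε⁻¹ * ((γ ^ n)⁻¹ * σ)).2⟩), Subgroup.mem_top _⟩
    have hσ : σ = γ ^ n * ε * (ε⁻¹ * ((γ ^ n)⁻¹ * σ)) := by group
    conv_lhs => rw [hσ, ContH1.conj_mul_apply, ContH1.conj_eq_self_of_mem _ hy']

/-- **`hdesc` at the model** — the orbit consists of the translates `τ n` (the `γⁿ`-conjugates of the root class) up
to `2`-torsion classes — HOLDS as soon as `ε` (the `μ₂`-part, `Ü ↦ −Ü`) moves the root class by a class of order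
dividing `2` (hypothesis `hsign`: [EtTh] Prop. 1.4 (ii) p. 20 "`Θ̈(−Ü) = −Θ̈(Ü)`" AT THE CLASS LEVEL — the Kummer class of
`−1`; an input here, plan/GAP-LEDGER.md G-w4d010-2 (P14ii-cl)). [claim: Mochizuki2012, status: disputed]
(IUTchII §2 Prop 2.2 (ii), kurims p.66) -/
theorem orbitOne_desc_of_sign (hC : D.Compat) (hS : D.Sec2Hyps) (γ ε : Pi C)
    (hγ : C.toLZ γ = Multiplicative.ofAdd 1) (hε₁ : (ε : D.PiTemp) ∈ D.GtpY) (hε₂ : (ε : D.PiTemp) ∉ D.GtpYdd)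
    (hsign : ∃ κ : ContH1 (phi C) (D.lDeltaTheta l) (PiYdd C ⊓ ⊤), κ ^ 2 = 1 ∧
      ContH1.conj (phi C) (D.lDeltaTheta l) ε (rootLiftClass C) = rootLiftClass C * κ) :
    ∀ o ∈ orbitOne C hC, ∃ (n : ℤ) (c : (coh C).H1 ⊤), 2 • c = 0 ∧
      o = (h1Top C).symm (Additive.ofMul
        (ContH1.conj (phi C) (D.lDeltaTheta l) (γ ^ n) (rootLiftClass C))) + c := by
  intro o ho
  obtain ⟨κ, hκ2, hκ⟩ := hsign
  obtain ⟨n, h | h⟩ := orbitOne_subset_translates C hC hS γ ε hγ hε₁ hε₂ ho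
  · exact ⟨n, 0, smul_zero _, by rw [add_zero]; exact h⟩
  · refine ⟨n, (h1Top C).symm (Additive.ofMul (ContH1.conj (phi C) (D.lDeltaTheta l) (γ ^ n) κ)), ?_, ?_⟩
    · rw [← map_nsmul, ← ofMul_pow, ← map_pow, hκ2, map_one, ofMul_one, map_zero]
    · rw [h, ContH1.conj_mul_apply, hκ, map_mul, ofMul_mul, map_add]

/-- **IUTchII:Prop2.2(ii)′ at the model `Π_v := Π^tp_X̲̲`** ([IUTchII] Prop. 2.2 (ii), kurims p. 66): for the Prop. 1.4
output `D := etaleThetaDataOfSetting' C hC hS hchar S eS hl` and any Prop. 2.2 (i) datum `Dec` over it, the repaired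
`Prop22_ii' Dec` HOLDS given: the `ι`-actions `ρ`, `ρlim` on `H¹` and its limit (compatible) stabilising the orbit
(abc-iut-L6-t1's `CohomologyAutFunctoriality` at the pointed inversion); `ε` moves the root class by a class of
order dividing `2` (`hsign`, [EtTh] Prop. 1.4 (ii) at the class level); `ι` carries the `γⁿ`-conjugate of the root
class to the `γ⁻ⁿ`-conjugate up to torsion (`hrev`: `ι` reverses the `ℤ`-torsor of components, Rmk. 2.1.1 (i), and
fixes `η̲̈^Θ` up to the class of `−1`); distinct `γ`-translates differ by non-torsion classes (`hfree`, [EtTh] Prop. 1.4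
(i)/(iii) at the class level). The translates `τ n`, `τ 0 ∈ orbit` and the orbit description `hdesc` of
`prop22_ii'_of_translates` are DISCHARGED here (`orbitOne_desc_of_sign`). [claim: Mochizuki2012, status: disputed]
(IUTchII §2 Prop 2.2 (ii), kurims pp.66-67) -/
theorem prop22_ii'_etaleThetaDataOfSetting (hC : D.Compat) (hS : D.Sec2Hyps) (hchar : PiYddCharacteristic C)
    (S : BadPlaceSetting.{0}) (eS : (Pi C) ≃ₜ* S.PiX) (hl : S.l = l)
    {T : TemperedCoverings S (Pi C)}
    (Dec : SubgraphDecomposition S T (etaleThetaDataOfSetting' C hC hS hchar S.toThetaSetting eS hl))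
    (ρ : (coh C).H1 ⊤ ≃+ (coh C).H1 ⊤) (ρlim : (coh C).lim ≃+ (coh C).lim)
    (hcompat : ∀ x, (coh C).toLim ⊤ (ρ x) = ρlim ((coh C).toLim ⊤ x))
    (horbit : ρ '' orbitOne C hC = orbitOne C hC)
    (γ ε : Pi C) (hγ : C.toLZ γ = Multiplicative.ofAdd 1) (hε₁ : (ε : D.PiTemp) ∈ D.GtpY)
    (hε₂ : (ε : D.PiTemp) ∉ D.GtpYdd)
    (hsign : ∃ κ : ContH1 (phi C) (D.lDeltaTheta l) (PiYdd C ⊓ ⊤), κ ^ 2 = 1 ∧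
      ContH1.conj (phi C) (D.lDeltaTheta l) ε (rootLiftClass C) = rootLiftClass C * κ)
    (hrev : ∀ n : ℤ, IsOfFinAddOrder
      (ρ ((h1Top C).symm (Additive.ofMul (ContH1.conj (phi C) (D.lDeltaTheta l) (γ ^ n) (rootLiftClass C)))) -
        (h1Top C).symm (Additive.ofMul (ContH1.conj (phi C) (D.lDeltaTheta l) (γ ^ (-n)) (rootLiftClass C)))))
    (hfree : ∀ m n : ℤ, IsOfFinAddOrder
      ((h1Top C).symm (Additive.ofMul (ContH1.conj (phi C) (D.lDeltaTheta l) (γ ^ m) (rootLiftClass C))) -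
        (h1Top C).symm (Additive.ofMul (ContH1.conj (phi C) (D.lDeltaTheta l) (γ ^ n) (rootLiftClass C)))) →
      m = n) :
    Prop22_ii' Dec :=
  prop22_ii'_of_translates Dec ρ ρlim hcompat horbit
    (fun n => (h1Top C).symm (Additive.ofMul (ContH1.conj (phi C) (D.lDeltaTheta l) (γ ^ n) (rootLiftClass C))))
    ⟨γ ^ (0 : ℤ), rfl⟩ (orbitOne_desc_of_sign C hC hS γ ε hγ hε₁ hε₂ hsign) hrev hfree

end

end Literature.IUT.HodgeArakelov
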